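import Summits.QuantumFields.BalabanUV.Beta.EriceRemainderEnclosureHistoryAutonomyComparisonAgeCompositionNestedMoments

/-!
# EriceRemainderEnclosureHistoryAutonomyComparisonAgeCompositionNestedYoungPair — (E92d) route (N), first order: THE NESTED STEP WITH THE YOUNG-PAIR
# SHARE BOUND — EVERY OLD TAIL OF THE CENSUS THREE AGES IS CLOSED FROM `k₂ ≥ 14`.  (E92c)'s nested wedge charges the young and the middle load at
# their individual caps `√2∕2` each, which costs a factor `(1 − √2∕2)²` and forces `k₂ ≥ 81`; but the young PAIR `{1, k₂}` is itself share-bounded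
# inside the three-age profile ((E92b) `pair_load_le_of_ratio`: `x₁ + x₂ ≤ σ = √2∕(1+p₀)`, `p₀⁴(k₂+1) ≤ 2`).  Keeping the actual loads `x₁, x₂` through
# both residual steps gives `ε ≥ g(x₁, x₂)·e` with `g` BILINEAR, decreasing in the middle load, so `g ≥ 0` on the pentagon `{x₁, x₂ ≤ √2∕2, x₁ + x₂ ≤ σ}`
# as soon as it is `≥ 0` at the two vertices `(σ − √2∕2, √2∕2)`, `(√2∕2, σ − √2∕2)` (an affine edge and a concave edge): ONE displayed inequality
# `2√2·Q·(1∕k₂ + 1∕k₃) + (k₂+1)∕k₃ ≤ (1 − √2∕2)²`, `Q = (σ − √2∕2)∕(1 + √2∕2 − σ)`.  Rational instances: `14 ≤ k₂ ≤ 29 ∧ k₃ ≥ 1500`,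
# `30 ≤ k₂ ≤ 66 ∧ k₃ ≥ 1600`, `67 ≤ k₂ ≤ 100 ∧ k₃ ≥ 1800`, `101 ≤ k₂ ≤ 229 ∧ k₃ ≥ 3600` — with (E92c) (`k₂ ≥ 230`: every `k₃`) and (E92b) (R2:
# `k₂ ≤ 66`) EVERY TAIL `k₃ → ∞` of the census three ages is typed, and what is left of «three ages at every ratio» is a BOUNDED set of `(k₂, k₃)`

Cell `pub-balaban`, β-function sub-cell, BINDER row D4 «RemainderConst leaves for Bałaban's split» (`HOME/BINDER-OWNERS.md`; owner lineage `b2b-balaban-beta-an4`;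
this file by co-owner #2 lineage `b2b-balaban-beta-d4-p2`, generation 83), β-FLOW TEAM duty (1), FREEZE (0) honoured (def-free; nothing restated).

HONEST FRAMING (page 1, verbatim and binding).  *"Discharging BetaPertH makes Bałaban's UV stability UNCONDITIONAL — a real constructive-QFT result; it is
NOT the continuum limit and NOT the Clay problem."*  THIS FILE DISCHARGES NOTHING OF THE KIND.  Elementary real algebra ∕ real analysis about ABSTRACT
functionals on a box ]0,γ]^ℕ with displayed floors, profiles and signs, and the FIRST-ORDER renewal objects of route (N) built from them — hypotheses of a
census, not facts; the form, signs, ages and moments of Bałaban's (1.22) limit functional are NOT PRINTED ([I] p. 298; GAPS G-t4-U2-1∕-2) and NOT asserted.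
Row D4 class UNCHANGED (critical-path width 0; instance 0∕1; D4 DISCHARGE NO DATE).  HONEST DEPENDENCY: continuum YM on T⁴ ⇐ BetaPertH ∧ nine spine
estimates (0/9 proved); BetaPertH ⇐ (D1) ∧ (D4) ∧ CAP+tail; G-an2-4 gates asym, D1 and NE2/3/4.

THE POINT (README `HOME/b2b-balaban-beta-d4-p2/g83/e92/README.md` §2–§4).  With `s = √2∕2`, `τ = √2(k₂+1)∕k₃`, `B = 4∕k₂`, `C = 2√2∕k₃`, `A = (1−s)+τ`:
the middle step ((E92c) `residual_step_moment` with `sy = x₂`) gives `e − O − M ≥ [(1−x₂)(1−s) − x₂τ]·e`, the young step (`sy = x₁`, first moment `c₁`)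
gives `ε ≥ [(1−x₁)((1−s) − x₂A) − Bx₁x₂ − Cx₁]·e = g(x₁,x₂)·e`, `g = (1−s) − ((1−s)+C)x₁ − Ax₂ + (A−B)x₁x₂`; for `k₂ ≥ 14`, `A ≥ B`, so `g` is
bilinear with `∂g∕∂x₂ ≤ 0` on `x₁ ≤ s`; on the pentagon its minimum is at `(0,s)`, `(σ−s,s)` (affine edge) or on the concave edge `x₁ + x₂ = σ` with ends
`(σ−s,s)`, `(s,σ−s)` (§1 `pentagon_bilinear_nonneg`); `g(s,σ−s) − g(σ−s,s) = (2s−σ)(τ−C) ≥ 0`, and `g(σ−s,s) ≥ 0` is the displayed inequality.  Uses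
(E92c) `residual_step_moment`∕`row_moment_le`, (E92b) `pair_load_le_of_ratio`, (E92a) `renewal_bounds_of_step`, (E91a) `old_read_variation`, (E82a)
`kernel_entry_le`∕`row_mass_le`, (E89b) `window_load_le_sqrt_two_div_two`, (E80b) `aggregate_eq_sum` BY NAME.  NOT CLAIMED: `k₂ ≤ 13`; the bounded
gap tabulated in README §3 (e.g. `k₂ = 20`: `57 ≤ k₃ ≤ 434`; `k₂ = 100`: `947 ≤ k₃ ≤ 1413` — mass-certificate territory, NOT typed); anything printed —
NOT B12 Thm 2, NOT BetaPertH.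

WHAT IS PROVED ([folklore]; 0 `def`, 0 sorry).  §1 (pure) `affine_nonneg_on_interval`, `concave_quad_nonneg_on_interval`, **`pentagon_bilinear_nonneg`**.
§2 **`flow_nonneg_census_three_ages_young_pair`** (parametric `p₀`, one displayed inequality).  The rational instances (every old tail from `k₂ ≥ 14`)
are in (E92e) `…NestedYoungPairTails`.
-/
noncomputable section
open Finset

namespace Summit.QuantumFields.BalabanUV.Beta.EriceRemainderEnclosureHistoryAutonomyComparisonAgeCompositionNestedYoungPair

open Literature.MathematicalPhysics.QuantumFieldTheory.Balaban1983to89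
open Literature.MathematicalPhysics.QuantumFieldTheory.Balaban1983to89.T4BetaStationary
open Literature.MathematicalPhysics.QuantumFieldTheory.Balaban1983to89.T4BetaFlowWellPosed
open Summit.QuantumFields.BalabanUV.Beta.EriceRemainderEnclosureHistoryAutonomyComparisonAgeCompositionTwoAgesOldRead (old_read_variation)
open Summit.QuantumFields.BalabanUV.Beta.EriceRemainderEnclosureHistoryAutonomyComparisonAgeCompositionThreeAgesMassCap
  (window_load_le_sqrt_two_div_two)
open Summit.QuantumFields.BalabanUV.Beta.EriceRemainderEnclosureHistoryAutonomyComparisonAgeCompositionYoungestTailSumFlow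
  (kernel_entry_le row_mass_le)
open Summit.QuantumFields.BalabanUV.Beta.EriceRemainderEnclosureHistoryAutonomyComparisonAgeCompositionChainWiring (aggregate_eq_sum)
open Summit.QuantumFields.BalabanUV.Beta.EriceRemainderEnclosureHistoryAutonomyComparisonAgeCompositionNestedReads (renewal_bounds_of_step)
open Summit.QuantumFields.BalabanUV.Beta.EriceRemainderEnclosureHistoryAutonomyComparisonAgeCompositionPairShares (pair_load_le_of_ratio)
open Summit.QuantumFields.BalabanUV.Beta.EriceRemainderEnclosureHistoryAutonomyComparisonAgeCompositionNestedMoments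
  (residual_step_moment row_moment_le)

variable {B : (ℕ → ℝ) → ℝ} {γ b gIR : ℝ} {L : ℕ → ℝ} {K : ℕ} {h g : ℕ → ℝ}

/-! ## §1 A bilinear form on a pentagon -/

/-- An affine function of `t` non-negative at both ends of an interval is non-negative on it. [folklore] -/
theorem affine_nonneg_on_interval {a c t₀ t₁ t : ℝ} (h0 : 0 ≤ a + c * t₀) (h1 : 0 ≤ a + c * t₁) (ht0 : t₀ ≤ t) (ht1 : t ≤ t₁) :
    0 ≤ a + c * t := by
  rcases le_or_gt 0 c with hc | hc
  · nlinarith [mul_nonneg hc (sub_nonneg.2 ht0)]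
  · nlinarith [mul_nonneg (neg_nonneg.2 hc.le) (sub_nonneg.2 ht1)]

/-- A concave quadratic `a + c·t − d·t²` (`d ≥ 0`) non-negative at both ends of an interval is non-negative on it:
`(t₁−t₀)·q(t) = (t₁−t)·q(t₀) + (t−t₀)·q(t₁) + d(t₁−t₀)(t−t₀)(t₁−t)`. [folklore] -/
theorem concave_quad_nonneg_on_interval {a c d t₀ t₁ t : ℝ} (hd : 0 ≤ d) (h0 : 0 ≤ a + c * t₀ - d * t₀ ^ 2)
    (h1 : 0 ≤ a + c * t₁ - d * t₁ ^ 2) (ht0 : t₀ ≤ t) (ht1 : t ≤ t₁) : 0 ≤ a + c * t - d * t ^ 2 := by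
  rcases (ht0.trans ht1).eq_or_lt with heq | hlt
  · have : t = t₀ := le_antisymm (by rw [heq]; exact ht1) ht0
    rw [this]; exact h0
  have key : (t₁ - t₀) * (a + c * t - d * t ^ 2)
      = (t₁ - t) * (a + c * t₀ - d * t₀ ^ 2) + (t - t₀) * (a + c * t₁ - d * t₁ ^ 2) + d * (t₁ - t₀) * (t - t₀) * (t₁ - t) := by ring
  have hR : 0 ≤ (t₁ - t) * (a + c * t₀ - d * t₀ ^ 2) + (t - t₀) * (a + c * t₁ - d * t₁ ^ 2) + d * (t₁ - t₀) * (t - t₀) * (t₁ - t) := by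
    have := mul_nonneg (sub_nonneg.2 ht1) h0
    have := mul_nonneg (sub_nonneg.2 ht0) h1
    have := mul_nonneg (mul_nonneg (mul_nonneg hd (sub_nonneg.2 hlt.le)) (sub_nonneg.2 ht0)) (sub_nonneg.2 ht1)
    linarith
  by_contra hneg
  have : (t₁ - t₀) * (a + c * t - d * t ^ 2) < 0 := mul_neg_of_pos_of_neg (sub_pos.2 hlt) (not_le.mp hneg)
  linarith

/-- **A BILINEAR FORM ON THE PENTAGON.**  `g(x,y) = G₀ − G₁x − G₂y + G₁₂xy` with `G₁₂ ≥ 0` and `G₁₂·s ≤ G₂` (so `g` is non-increasing in `y` for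
`x ≤ s`) is `≥ 0` on `{0 ≤ x ≤ s, y ≤ s, x + y ≤ σ}` as soon as `g(0,s) ≥ 0`, `g(σ−s,s) ≥ 0` and `g(s,σ−s) ≥ 0`: push `y` up to
`min(s, σ−x)`; on `x ≤ σ−s` the edge `y = s` is affine in `x`, on `x ≥ σ−s` the edge `y = σ−x` is a concave quadratic. [folklore] -/
theorem pentagon_bilinear_nonneg {s σ G₀ G₁ G₂ G₁₂ x y : ℝ} (hx0 : 0 ≤ x) (hxs : x ≤ s) (hys : y ≤ s) (hxy : x + y ≤ σ)
    (hG12 : 0 ≤ G₁₂) (hslope : G₁₂ * s ≤ G₂)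
    (v2 : 0 ≤ G₀ - G₂ * s) (v3 : 0 ≤ G₀ - G₁ * s - G₂ * (σ - s) + G₁₂ * s * (σ - s))
    (v4 : 0 ≤ G₀ - G₁ * (σ - s) - G₂ * s + G₁₂ * (σ - s) * s) :
    0 ≤ G₀ - G₁ * x - G₂ * y + G₁₂ * x * y := by
  -- the slope in y is ≤ 0 for x ≤ s
  have hslx : 0 ≤ G₂ - G₁₂ * x := by nlinarith [mul_le_mul_of_nonneg_left hxs hG12]
  by_cases hc : x ≤ σ - s
  · -- push y up to s; then affine in x on [0, σ − s]
    have h1 : G₀ - G₁ * x - G₂ * s + G₁₂ * x * s ≤ G₀ - G₁ * x - G₂ * y + G₁₂ * x * y := by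
      nlinarith [mul_nonneg hslx (sub_nonneg.2 hys)]
    have h2 : 0 ≤ (G₀ - G₂ * s) + (G₁₂ * s - G₁) * x :=
      affine_nonneg_on_interval (t₀ := 0) (t₁ := σ - s) (by linarith) (by linarith) hx0 hc
    linarith
  · -- push y up to σ − x; then a concave quadratic in x on [σ − s, s]
    have hc' : σ - s ≤ x := (not_le.mp hc).le
    have h1 : G₀ - G₁ * x - G₂ * (σ - x) + G₁₂ * x * (σ - x) ≤ G₀ - G₁ * x - G₂ * y + G₁₂ * x * y := by
      nlinarith [mul_nonneg hslx (show 0 ≤ σ - x - y by linarith)]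
    have h2 : 0 ≤ (G₀ - G₂ * σ) + (G₂ - G₁ + G₁₂ * σ) * x - G₁₂ * x ^ 2 :=
      concave_quad_nonneg_on_interval (t₀ := σ - s) (t₁ := s) hG12 (by linarith) (by linarith) hc' hxs
    linarith

/-! ## §2 The census three ages with the young-pair share bound kept through the nested steps -/
set_option maxHeartbeats 400000 in
/-- **THE CENSUS THREE AGES `{1, k₂, k₃}`, `k₂ ≥ 14`: THE END ALONG EVERY FLOW FROM ONE DISPLAYED INEQUALITY BETWEEN THE YOUNG-PAIR SLACK AND THE
MIDDLE∕OLD RATIO.**  Profile carried by `{1, k₂, k₃}`, `14 ≤ k₂ < k₃ < K`; dampings of the self-consistent class `g_t(1+F_t) ≥ 1`; `p₀ ≥ 0` with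
`p₀⁴(k₂+1) ≤ 2` (so `x₁ + x₂ ≤ σ := √2∕(1+p₀)` by (E92b)); IF
`2√2·Q·(1∕k₂ + 1∕k₃) + (k₂+1)∕k₃ ≤ (1 − √2∕2)²` with `Q = (σ − √2∕2)∕(1 + √2∕2 − σ)`, THEN `0 ≤ ε ≤ e` at every pin for every admissible excess and
every horizon.  (`p₀ → 0`: `Q = 1∕√2 … ` recovers (E92c)'s `80(k₂+k₃) + 12k₂(k₂+1) ≤ k₂k₃` up to rounding; `p₀ → 1`: `Q → 0`, `k₃ ≥ 12(k₂+1)`.)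
[folklore] -/
theorem flow_nonneg_census_three_ages_young_pair (hmono : ∀ u v : ℕ → ℝ, SeqBox γ u → SeqBox γ v → (∀ j, u j ≤ v j) → B u ≤ B v)
    (hL : ∀ k, 0 ≤ L k) (hb : 0 < b) (hlo : ∀ u, SeqBox γ u → b ≤ B u) (hdom : ∀ u, SeqBox γ u → ∑ k ∈ range K, L k * u k ≤ B u)
    (hh : SeqBox γ h) (hf : MemFlow B gIR h) (hg : ∀ t, 0 < g t ∧ g t ≤ 1)
    (hgF : ∀ t, 1 ≤ g t * (1 + ∑ k ∈ range K, L k * h (t + k) ^ 3 / 2))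
    {k₂ k₃ : ℕ} (hk2 : 14 ≤ k₂) (hk23 : k₂ < k₃) (hk3K : k₃ < K) (hL3 : ∀ j, j < K → j ≠ 1 → j ≠ k₂ → j ≠ k₃ → L j = 0)
    {p₀ : ℝ} (hp0 : 0 ≤ p₀) (hp : p₀ ^ 4 * ((k₂ : ℝ) + 1) ≤ 2)
    (hv : 2 * Real.sqrt 2 * ((Real.sqrt 2 / (1 + p₀) - Real.sqrt 2 / 2) / (1 + Real.sqrt 2 / 2 - Real.sqrt 2 / (1 + p₀)))
        * (1 / (k₂ : ℝ) + 1 / (k₃ : ℝ)) + ((k₂ : ℝ) + 1) / k₃ ≤ (1 - Real.sqrt 2 / 2) ^ 2)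
    {N : ℕ} {KL : ℕ → ℕ → ℕ → ℝ}
    (hKL : ∀ k n l, KL k n l = if 0 < k ∧ k < K ∧ l < k then L k * h (n + k) ^ 3 / 2 * ∏ t ∈ Ico (n + 1 + l) (n + k + 1), g t else 0)
    {KA : ℕ → ℕ → ℕ → ℝ} {RA : ℕ → (ℕ → ℝ) → ℕ → ℝ}
    (hRA : ∀ i v m, RA i v m = ∑ l ∈ range K, KA i m l * v (m + 1 + l))
    (hKA : ∀ i m l, KA i m l = KL i m l + KA (i + 1) m l) (hKAtop : ∀ m l, KA K m l = 0)
    {e ε : ℕ → ℝ} (he0 : ∀ m, 0 ≤ e m) (hea : ∀ m, e (m + 1) ≤ e m)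
    (hεt : ∀ m, N < m → ε m = 0) (hεrec : ∀ m, ε m = e m - RA 1 ε m) : ∀ m, 0 ≤ ε m ∧ ε m ≤ e m := by
  have hpos : ∀ n, 0 < h n := fun n => (hh n).1
  have h1K : 1 < K := by omega
  have hk2K : k₂ < K := by omega
  have hj : 0 < k₂ := by omega
  have hk : 0 < k₃ := by omega
  have hK : 1 ≤ K := by omega
  have hL0 : L 0 = 0 := hL3 0 (by omega) (by omega) (by omega) (by omega)
  have hs2 : Real.sqrt 2 ^ 2 = 2 := Real.sq_sqrt (by norm_num)
  have hs0 : 0 ≤ Real.sqrt 2 := Real.sqrt_nonneg 2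
  have hs17 : Real.sqrt 2 ≤ 17 / 12 := Real.sqrt_le_iff.mpr ⟨by norm_num, by norm_num⟩
  have hs99 : Real.sqrt 2 ≤ 99 / 70 := Real.sqrt_le_iff.mpr ⟨by norm_num, by norm_num⟩
  have hs1 : (1 : ℝ) ≤ Real.sqrt 2 := by rw [Real.le_sqrt (by norm_num) (by norm_num)]; norm_num
  have hjr : (0 : ℝ) < k₂ := by exact_mod_cast hj
  have hkr : (0 : ℝ) < k₃ := by exact_mod_cast hk
  have hk2r : (14 : ℝ) ≤ k₂ := by exact_mod_cast hk2
  have hk23r : (k₂ : ℝ) + 1 ≤ k₃ := by exact_mod_cast hk23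
  have h1p : 0 < 1 + p₀ := by linarith
  have hea' : ∀ p q, p ≤ q → e q ≤ e p := by
    intro p q hpq
    induction q, hpq using Nat.le_induction with
    | base => exact le_rfl
    | succ q _ ih => exact (hea q).trans ih
  -- abbreviations (pure numbers)
  set s : ℝ := Real.sqrt 2 / 2 with hs_def
  set σ : ℝ := Real.sqrt 2 / (1 + p₀) with hσ_def
  set τ : ℝ := Real.sqrt 2 * ((k₂ : ℝ) + 1) / k₃ with hτ_def
  set Bc : ℝ := 4 / (k₂ : ℝ) with hB_def
  set Cc : ℝ := 2 * Real.sqrt 2 / (k₃ : ℝ) with hC_def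
  have hk2ne : (k₂ : ℝ) ≠ 0 := hjr.ne'
  have hk3ne : (k₃ : ℝ) ≠ 0 := hkr.ne'
  have hs0' : 0 ≤ s := by rw [hs_def]; positivity
  have hs_lt1 : s < 1 := by rw [hs_def]; linarith
  have hc0 : 0 ≤ 1 - s := by linarith
  have hτ0 : 0 ≤ τ := by positivity
  have hB0 : 0 ≤ Bc := by positivity
  have hC0 : 0 ≤ Cc := by positivity
  -- p₀ < 1, hence s ≤ σ ≤ 2s
  have hp1 : p₀ ≤ 1 := by
    by_contra hgt
    have hgt' : 1 < p₀ := not_le.mp hgt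
    have h4 : 1 < p₀ ^ 4 := one_lt_pow₀ hgt' (by norm_num)
    have := mul_le_mul_of_nonneg_right h4.le (show (0 : ℝ) ≤ (k₂ : ℝ) + 1 by positivity)
    linarith
  have hsσ : s ≤ σ := by
    rw [hs_def, hσ_def]; exact div_le_div_of_nonneg_left hs0 h1p (by linarith)
  have hσ2 : σ ≤ Real.sqrt 2 := by rw [hσ_def]; exact div_le_self hs0 (by linarith)
  have hw : 0 < 1 + s - σ := by linarith
  -- A ≥ B (k₂ ≥ 14), τ ≥ C (k₂ ≥ 1)
  have hAB : Bc ≤ (1 - s) + τ := by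
    have : Bc ≤ 4 / 14 := by rw [hB_def]; exact div_le_div_of_nonneg_left (by norm_num) (by norm_num) hk2r
    rw [hs_def]; linarith
  have hτC : Cc ≤ τ := by
    rw [hC_def, hτ_def, div_le_div_iff_of_pos_right hkr]
    nlinarith [mul_le_mul_of_nonneg_left hk2r hs0]
  -- the displayed inequality in the abbreviations: 2√2·Q(1∕k₂ + 1∕k₃) = (s·(σ−s)·B + (σ−s)·C)∕(1+s−σ)·…; unpack it into v4 ≥ 0
  have hQ : 2 * Real.sqrt 2 * ((σ - s) / (1 + s - σ)) * (1 / (k₂ : ℝ) + 1 / (k₃ : ℝ)) + ((k₂ : ℝ) + 1) / k₃ ≤ (1 - s) ^ 2 := by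
    simpa [hs_def, hσ_def] using hv
  have hv4 : 0 ≤ (1 - s) ^ 2 * (1 + s - σ) - (σ - s) * Cc - s * (1 + s - σ) * τ - s * (σ - s) * Bc := by
    -- multiply hQ by (1 + s − σ) > 0
    have h1 := mul_le_mul_of_nonneg_left hQ hw.le
    have hQfrac : (1 + s - σ) * ((σ - s) / (1 + s - σ)) = σ - s := by rw [← mul_div_assoc, mul_div_cancel_left₀ _ hw.ne']
    have e0 : (1 + s - σ) * (2 * Real.sqrt 2 * ((σ - s) / (1 + s - σ)) * (1 / (k₂ : ℝ) + 1 / (k₃ : ℝ)) + ((k₂ : ℝ) + 1) / k₃)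
        = 2 * Real.sqrt 2 * ((1 + s - σ) * ((σ - s) / (1 + s - σ))) * (1 / (k₂ : ℝ) + 1 / (k₃ : ℝ)) + (1 + s - σ) * (((k₂ : ℝ) + 1) / k₃) := by
      ring
    have e1 : 2 * Real.sqrt 2 * (σ - s) * (1 / (k₂ : ℝ) + 1 / (k₃ : ℝ)) + (1 + s - σ) * (((k₂ : ℝ) + 1) / k₃)
        = (σ - s) * Cc + s * (σ - s) * Bc + s * (1 + s - σ) * τ := by
      rw [hC_def, hB_def, hτ_def, hs_def]
      linear_combination (-(1 / 2) * (1 + Real.sqrt 2 / 2 - σ) * (((k₂ : ℝ) + 1) / k₃)) * hs2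
    rw [e0, hQfrac] at h1
    linarith [h1, e1]
  have hv2 : τ * s ≤ (1 - s) ^ 2 := by
    -- from hQ: (k₂+1)∕k₃ ≤ (1−s)² and τ·s = (k₂+1)∕k₃
    have hQ0 : 0 ≤ 2 * Real.sqrt 2 * ((σ - s) / (1 + s - σ)) * (1 / (k₂ : ℝ) + 1 / (k₃ : ℝ)) := by
      have : 0 ≤ (σ - s) / (1 + s - σ) := div_nonneg (by linarith) hw.le
      positivity
    have e1 : τ * s = ((k₂ : ℝ) + 1) / k₃ := by
      rw [hτ_def, hs_def]
      linear_combination ((((k₂ : ℝ) + 1) / k₃) / 2) * hs2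
    rw [e1]; linarith
  -- the data of §1 `pentagon_bilinear_nonneg` with G₀ = 1−s, G₁ = (1−s)+C, G₂ = A = (1−s)+τ, G₁₂ = A − B
  have hG12 : 0 ≤ (1 - s) + τ - Bc := by linarith only [hAB]
  have hslope : ((1 - s) + τ - Bc) * s ≤ (1 - s) + τ := by
    nlinarith [mul_nonneg (add_nonneg hc0 hτ0) hc0, mul_nonneg hB0 hs0']
  have hV2 : 0 ≤ (1 - s) - ((1 - s) + τ) * s := by linarith only [hv2]
  have hV4 : 0 ≤ (1 - s) - ((1 - s) + Cc) * (σ - s) - ((1 - s) + τ) * s + ((1 - s) + τ - Bc) * (σ - s) * s := by linarith only [hv4]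
  have hV3 : 0 ≤ (1 - s) - ((1 - s) + Cc) * s - ((1 - s) + τ) * (σ - s) + ((1 - s) + τ - Bc) * s * (σ - s) := by
    have : 0 ≤ (2 * s - σ) * (τ - Cc) := mul_nonneg (by rw [hs_def]; linarith only [hσ2]) (by linarith only [hτC])
    linarith only [hv4, this]
  -- the aggregate row is the young row plus the middle row plus the old row
  have hKA1 : ∀ m l, KA 1 m l = KL 1 m l + (KL k₂ m l + KL k₃ m l) := by
    intro m l
    have h1 : KA 1 m l = ∑ k' ∈ Ico 1 (K - 1 + 1), KL k' m l :=
      aggregate_eq_sum (n := K - 1) hKA (fun m l => by rw [Nat.sub_add_cancel hK]; exact hKAtop m l) (show 1 ≤ K - 1 + 1 by omega) m l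
    rw [h1, Nat.sub_add_cancel hK]
    have hsub : ({1, k₂, k₃} : Finset ℕ) ⊆ Ico 1 K := by
      intro x hx
      simp only [mem_insert, mem_singleton] at hx
      rw [mem_Ico]; rcases hx with rfl | rfl | rfl <;> omega
    rw [← sum_subset hsub (fun x hx hxn => by
      simp only [mem_insert, mem_singleton, not_or] at hxn
      rw [hKL]
      split_ifs
      · rw [hL3 x (mem_Ico.mp hx).2 hxn.1 hxn.2.1 hxn.2.2]; simp
      · rfl), sum_insert (by simp only [mem_insert, mem_singleton]; omega), sum_pair (by omega)]
  have hrec3 : ∀ p, ε p = e p - ∑ l ∈ range K, KL 1 p l * ε (p + 1 + l)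
      - (∑ l ∈ range K, KL k₂ p l * ε (p + 1 + l) + ∑ l ∈ range K, KL k₃ p l * ε (p + 1 + l)) := by
    intro p
    rw [hεrec p, hRA]
    have : ∑ l ∈ range K, KA 1 p l * ε (p + 1 + l) = ∑ l ∈ range K, KL 1 p l * ε (p + 1 + l)
        + (∑ l ∈ range K, KL k₂ p l * ε (p + 1 + l) + ∑ l ∈ range K, KL k₃ p l * ε (p + 1 + l)) := by
      rw [← sum_add_distrib, ← sum_add_distrib]; exact sum_congr rfl fun l _ => by rw [hKA1]; ring
    rw [this]; ring
  refine renewal_bounds_of_step he0 hεt fun m IH => ?_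
  have hread0 : ∀ a p, m ≤ p → 0 ≤ ∑ l ∈ range K, KL a p l * ε (p + 1 + l) := fun a p hp =>
    sum_nonneg fun l _ => mul_nonneg (kernel_entry_le hL hh hg hKL a p l).1 (IH _ (by omega)).1
  have hreadle : ∀ {a : ℕ}, a < K → ∑ l ∈ range K, KL a m l * ε (m + 1 + l) ≤ (a : ℝ) * (L a * h (m + a) ^ 3 / 2) * e m := by
    intro a haK
    calc ∑ l ∈ range K, KL a m l * ε (m + 1 + l) ≤ ∑ l ∈ range K, KL a m l * e m :=
          sum_le_sum fun l _ => mul_le_mul_of_nonneg_left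
            (((IH _ (by omega)).2).trans (hea' m (m + 1 + l) (by omega))) (kernel_entry_le hL hh hg hKL a m l).1
      _ = (∑ l ∈ range K, KL a m l) * e m := by rw [sum_mul]
      _ ≤ (a : ℝ) * (L a * h (m + a) ^ 3 / 2) * e m := mul_le_mul_of_nonneg_right (row_mass_le hL hh hg hKL haK m) (he0 m)
  -- the three loads at the pin and the young-pair share bound
  have hx1' := window_load_le_sqrt_two_div_two hmono hL hb hlo hdom hh hf h1K m
  have hx2 := window_load_le_sqrt_two_div_two hmono hL hb hlo hdom hh hf hk2K m
  have hx3 := window_load_le_sqrt_two_div_two hmono hL hb hlo hdom hh hf hk3K m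
  have hpair' := pair_load_le_of_ratio hmono hL hb hlo hdom hh hf le_rfl (show 1 < k₂ by omega) hk2K hp0 (by push_cast; linarith) m
  set c1 := L 1 * h (m + 1) ^ 3 / 2 with hc1_def
  set c2 := L k₂ * h (m + k₂) ^ 3 / 2 with hc2_def
  set c3 := L k₃ * h (m + k₃) ^ 3 / 2 with hc3_def
  have hc10 : 0 ≤ c1 := by have := hL 1; have := hpos (m + 1); positivity
  have hc20 : 0 ≤ c2 := by have := hL k₂; have := hpos (m + k₂); positivity
  have hc30 : 0 ≤ c3 := by have := hL k₃; have := hpos (m + k₃); positivity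
  have hx1 : c1 ≤ s := by rw [hs_def]; simpa using hx1'
  have hpair : c1 + (k₂ : ℝ) * c2 ≤ σ := by rw [hσ_def]; simpa using hpair'
  have hx2s : (k₂ : ℝ) * c2 ≤ s := by rw [hs_def]; exact hx2
  have hx3s : (k₃ : ℝ) * c3 ≤ s := by rw [hs_def]; exact hx3
  have hem := he0 m
  -- STEP 1 (old residual): e − O ≥ (1 − x₃)e ≥ (1 − s)e ≥ 0
  have hOle : ∑ l ∈ range K, KL k₃ m l * ε (m + 1 + l) ≤ (k₃ : ℝ) * c3 * e m := hreadle hk3K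
  have hres1 : (1 - s) * e m ≤ e m - ∑ l ∈ range K, KL k₃ m l * ε (m + 1 + l) := by
    have := mul_le_mul_of_nonneg_right hx3s hem
    linarith only [hOle, this]
  have hres1' : 0 ≤ e m - ∑ l ∈ range K, KL k₃ m l * ε (m + 1 + l) := le_trans (mul_nonneg hc0 hem) hres1
  -- STEP 2 (middle against old, actual load x₂ = k₂c₂, first moment c₂k₂(k₂+1)∕2, variation 4c₃ per lag)
  have hW2 : ∑ l ∈ range K, KL k₂ m l ≤ (k₂ : ℝ) * c2 := row_mass_le hL hh hg hKL hk2K m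
  have hstep2 := residual_step_moment (i := k₂) (Kw := K) (m := m) (sy := (k₂ : ℝ) * c2) (V := 4 * c3)
    (M₁ := c2 * ((k₂ : ℝ) * ((k₂ : ℝ) + 1) / 2))
    (wy := fun l => KL k₂ m l) (O := fun p => ∑ l ∈ range K, KL k₃ p l * ε (p + 1 + l)) (e := e) (ε := ε)
    (fun l => (kernel_entry_le hL hh hg hKL k₂ m l).1) (fun l hl => by rw [hKL, if_neg (by omega)])
    hW2 (row_moment_le hL hh hg hKL hk2K m) (by positivity) he0 hea
    (fun q hq => by
      have := hrec3 q
      have h1 := hread0 1 q hq.le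
      have h2 := hread0 k₂ q hq.le
      linarith only [this, h1, h2])
    hres1'
    (fun d hd1 hdj => by
      have hdk : d ≤ k₃ := by omega
      have hv' := old_read_variation hmono hL hb hlo hdom hh hf hL0 hg hgF hKL hk hk3K hd1 hdk he0 hea IH
      rw [← hc3_def] at hv'
      linarith only [hv'])
  -- the middle residual with the actual load: e − O − M ≥ [(1 − x₂)(1 − s) − x₂τ]e ≥ 0
  have hR2 : ((1 - (k₂ : ℝ) * c2) * (1 - s) - (k₂ : ℝ) * c2 * τ) * e m
      ≤ e m - (∑ l ∈ range K, KL k₂ m l * ε (m + 1 + l) + ∑ l ∈ range K, KL k₃ m l * ε (m + 1 + l)) := by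
    have hx2le1 : 0 ≤ 1 - (k₂ : ℝ) * c2 := by linarith
    have h1 : (1 - (k₂ : ℝ) * c2) * ((1 - s) * e m) ≤ (1 - (k₂ : ℝ) * c2) * (e m - ∑ l ∈ range K, KL k₃ m l * ε (m + 1 + l)) :=
      mul_le_mul_of_nonneg_left hres1 hx2le1
    -- c₂·k₂(k₂+1)∕2 · 4c₃ = 2x₂(k₂+1)c₃ ≤ x₂·τ   (k₃c₃ ≤ s)
    have h2 : c2 * ((k₂ : ℝ) * ((k₂ : ℝ) + 1) / 2) * (4 * c3) ≤ (k₂ : ℝ) * c2 * τ := by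
      have hx20 : 0 ≤ (k₂ : ℝ) * c2 * (2 * ((k₂ : ℝ) + 1)) := by positivity
      have hc3' : c3 ≤ s / k₃ := by rw [le_div_iff₀ hkr]; linarith only [hx3s]
      have e1 : c2 * ((k₂ : ℝ) * ((k₂ : ℝ) + 1) / 2) * (4 * c3) = (k₂ : ℝ) * c2 * (2 * ((k₂ : ℝ) + 1)) * c3 := by ring
      have e2 : (k₂ : ℝ) * c2 * τ = (k₂ : ℝ) * c2 * (2 * ((k₂ : ℝ) + 1)) * (s / k₃) := by rw [hτ_def, hs_def]; ring
      rw [e1, e2]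
      exact mul_le_mul_of_nonneg_left hc3' hx20
    have h3 := mul_le_mul_of_nonneg_right h2 hem
    linarith only [hstep2, h1, h3]
  have hR2nn : 0 ≤ (1 - (k₂ : ℝ) * c2) * (1 - s) - (k₂ : ℝ) * c2 * τ := by
    -- = (1−s) − x₂·((1−s)+τ) ≥ (1−s) − s((1−s)+τ) = (1−s)² − sτ ≥ 0
    have : (k₂ : ℝ) * c2 * ((1 - s) + τ) ≤ s * ((1 - s) + τ) := mul_le_mul_of_nonneg_right hx2s (by linarith only [hc0, hτ0])
    linarith only [hv2, this]
  have hres2' : 0 ≤ e m - (∑ l ∈ range K, KL k₂ m l * ε (m + 1 + l) + ∑ l ∈ range K, KL k₃ m l * ε (m + 1 + l)) :=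
    le_trans (mul_nonneg hR2nn hem) hR2
  -- STEP 3 (young against both, actual load x₁ = c₁, first moment c₁, variation 4(c₂ + c₃) per lag)
  have hW1 : ∑ l ∈ range K, KL 1 m l ≤ c1 :=
    (row_mass_le hL hh hg hKL h1K m).trans (le_of_eq (by rw [hc1_def]; simp))
  have hM1 : ∑ l ∈ range K, KL 1 m l * ((l : ℝ) + 1) ≤ c1 :=
    (row_moment_le hL hh hg hKL h1K m).trans (le_of_eq (by rw [hc1_def]; norm_num))
  have hstep3 := residual_step_moment (i := 1) (Kw := K) (m := m) (sy := c1) (V := 4 * (c2 + c3)) (M₁ := c1)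
    (wy := fun l => KL 1 m l)
    (O := fun p => ∑ l ∈ range K, KL k₂ p l * ε (p + 1 + l) + ∑ l ∈ range K, KL k₃ p l * ε (p + 1 + l)) (e := e) (ε := ε)
    (fun l => (kernel_entry_le hL hh hg hKL 1 m l).1) (fun l hl => by rw [hKL, if_neg (by omega)])
    hW1 hM1 (by positivity) he0 hea
    (fun q hq => by
      have := hrec3 q
      have h1 := hread0 1 q hq.le
      linarith only [this, h1])
    hres2'
    (fun d hd1 hdi => by
      have hdj : d ≤ k₂ := by omega
      have hdk : d ≤ k₃ := by omega
      have hvj := old_read_variation hmono hL hb hlo hdom hh hf hL0 hg hgF hKL hj hk2K hd1 hdj he0 hea IH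
      have hvk := old_read_variation hmono hL hb hlo hdom hh hf hL0 hg hgF hKL hk hk3K hd1 hdk he0 hea IH
      rw [← hc2_def] at hvj
      rw [← hc3_def] at hvk
      linarith only [hvj, hvk])
  -- assemble: ε ≥ (1 − x₁)·R₂·e − 4c₁(c₂ + c₃)e ≥ g(x₁, x₂)·e with x₂ := k₂c₂
  have hεm : ε m = e m - ∑ l ∈ range K, KL 1 m l * ε (m + 1 + l)
      - (∑ l ∈ range K, KL k₂ m l * ε (m + 1 + l) + ∑ l ∈ range K, KL k₃ m l * ε (m + 1 + l)) := hrec3 m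
  refine ⟨?_, ?_⟩
  · have hx1le1 : 0 ≤ 1 - c1 := by linarith
    have h1 := mul_le_mul_of_nonneg_left hR2 hx1le1
    -- 4c₁c₂ = B·x₁·x₂ and 4c₁c₃ ≤ C·x₁
    have h2 : c1 * (4 * (c2 + c3)) ≤ Bc * c1 * ((k₂ : ℝ) * c2) + Cc * c1 := by
      have e1 : Bc * c1 * ((k₂ : ℝ) * c2) = 4 * c1 * c2 := by
        rw [hB_def, div_mul_eq_mul_div, div_mul_eq_mul_div, div_eq_iff hk2ne]; ring
      have hc3' : 4 * c3 ≤ Cc := by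
        rw [hC_def, le_div_iff₀ hkr]
        have : (k₃ : ℝ) * c3 ≤ Real.sqrt 2 / 2 := hx3
        linarith only [this]
      have := mul_le_mul_of_nonneg_left hc3' hc10
      linarith only [e1, this]
    have h3 := mul_le_mul_of_nonneg_right h2 hem
    -- the bilinear form at (x₁, x₂)
    have hg := pentagon_bilinear_nonneg (s := s) (σ := σ) (G₀ := 1 - s) (G₁ := (1 - s) + Cc) (G₂ := (1 - s) + τ) (G₁₂ := (1 - s) + τ - Bc)
      (x := c1) (y := (k₂ : ℝ) * c2) hc10 hx1 hx2s hpair hG12 hslope hV2 hV3 hV4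
    have hge : ((1 - s) - ((1 - s) + Cc) * c1 - ((1 - s) + τ) * ((k₂ : ℝ) * c2) + ((1 - s) + τ - Bc) * c1 * ((k₂ : ℝ) * c2)) * e m
        ≤ e m - ∑ l ∈ range K, KL 1 m l * ε (m + 1 + l)
          - (∑ l ∈ range K, KL k₂ m l * ε (m + 1 + l) + ∑ l ∈ range K, KL k₃ m l * ε (m + 1 + l)) := by
      linarith only [hstep3, h1, h3]
    rw [hεm]
    exact le_trans (mul_nonneg hg hem) hge
  · rw [hεm]
    linarith only [hread0 1 m le_rfl, hread0 k₂ m le_rfl, hread0 k₃ m le_rfl]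

end Summit.QuantumFields.BalabanUV.Beta.EriceRemainderEnclosureHistoryAutonomyComparisonAgeCompositionNestedYoungPair

end
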